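import Summits.BirchSwinnertonDyer.BirchSwinnertonDyer.Theorems.SchneiderFreeAdditiveX3PoitouTateIdeleProjection
import Literature.NumberTheory.GaloisRepresentations.HomDualLocalPairingPlace
import Literature.NumberTheory.GaloisRepresentations.IdeleLocalInvariantsPlaceSum
import HarnessLib

/-!
# hE (`poitouTate_selmerStructure_duality K`) for EVERY number field `K` — real places included — from ONE E-side
# idèle package per `(f, ŷ)`: the E-side value as the global invariant of an idèle class of a finite layer, its
# finite-place dictionary, and the archimedean transport at the real places (Milne *ADT* I Thm. 4.10 (b), Ex. 1.6 (c))

Cell `bsd-schneider`, seat `door-c4` g18 (archimedean lane).  Crux `stmt-BirchSwinnertonDyer-19295`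
`AnticycControlAdditiveK` (control corner; 19538 ControlFacts (i) = hE).  Sequel to door-c5 g17's
`SchneiderFreeAdditiveX3PoitouTateIdeleProjection` (`poitouTate_selmerStructure_duality_of_reciprocitySum`: hE ⟸ the
SIGN-FREE E-side reciprocity sum in global terms, for `inv := classBarInv K`, `π := ideleProjection K`), to door-c4 g18's
`HomDualLocalPairingPlace` (the `Sum.inl w` summand of that sum IS `± localInvInf E w β` under the archimedean transport) and
`IdeleLocalInvariantsPlaceSum` (`inv E β` as one sum over a `Finset (Place K)`).  Theorems only; no definition, no named fact,
no instance, no `sorry`.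

THE POINT.  door-c6 g18's assembly (L2) of hE is announced for TOTALLY COMPLEX `K` (where the archimedean summands vanish on
both sides).  This file isolates what the E-side must deliver PER `(f, ŷ, T₀)` for an ARBITRARY number field `K` and proves hE
from it: a finite Galois layer `E ⊆ K̄`, a `2`-cocycle `b` of `Gal(E/K)` in the idèles `J_E`, a class `x ∈ H¹(K, M)` and a finite
set of places `Tx ⊇ T₀ ∪ {v ∣ ∞}` such that
* (P0) `x` is unramified outside `Tx`;
* (P1) THE E-SIDE VALUE: `classBarInv K (ŷ ∘ ∂(f ≫ g)) = inv E [b]` (door-c4 g17 `exists_layer_classBarInv_comp_boundary_eq_idele` +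
  `IdeleCohomology.classInvAll_ideleToClass`: `β = iso^J_E ((f^{U_E})_* δ_{S^{U_E}} c)`, `ŷ = Inf_E c`);
* (P2) the finite local invariants of `[b]` vanish off `Tx` (`IdeleCohomology.exists_finset_forall_localInv_eq_zero`);
* (P3) THE FINITE DICTIONARY: `localInv E v [b] = inv_{K_v}((π_v ∘ f)_* res_v (δ₁^K x))` for every finite `v` (door-c5
  `localInv_eq_readout` + door-c6 g18 (L1) transport `[pull_{readoutPair} b] = (π_v ∘ f)_* res_v δ₁ x`);
* (P4) THE ARCHIMEDEAN TRANSPORT at every REAL `w`: `[pull_{archReadoutPair w} b] = 0 ↔ (π_w ∘ f)_* res_w (δ₁^K x) = 0`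
  (the same transport read through door-c4 g18's `archReadoutPair`; vacuous for totally complex `K`).
THEN hE holds for `K` (**`poitouTate_selmerStructure_duality_of_idelePackage`**): for `T' ⊇ Tx`,
`classBarInv K (ŷ ∘ ∂(f ≫ g)) = inv E [b] = Σ_{v ∈ T'} Sum.elim (localInvInf E · [b]) (localInv E · [b]) v` (`inv_eq_sum_place`;
all infinite places lie in `T'`), and termwise this is MINUS the summand of the reciprocity sum: at a finite `v` by (P3) and
`p613211`'s sign (`− inv_{K_v}(…)`), at an infinite `w` by `localInvInf_H2π_eq_neg_zmodToQmodZ_localTatePairingZMod_localReadout`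
(from (P4); both sides `2`-torsion; nothing needed at complex `w`).  So `Σ = 0 ⟹ classBarInv K (ŷ ∘ ∂(f ≫ g)) = −0 = 0`.
Also recorded: the TOTALLY COMPLEX case needs no (P4) and no `{v ∣ ∞} ⊆ Tx`
(**`poitouTate_selmerStructure_duality_of_idelePackage_of_isTotallyComplex`**) — the exact shape of door-c6 g18's (L2).

HONEST FRAMING: a reduction (theorems with displayed hypotheses on existing objects); the package (P1)–(P4) is NOT proved here
((P1),(P2) are tree theorems up to packaging; (P3) is door-c6 g18's (L1); (P4) its archimedean copy).  No case of Poitou–Tate or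
BSD is proved; crux 19295 stays open behind hE.

## References
* J. S. Milne, *Arithmetic Duality Theorems* (2nd ed. 2006), I Thm. 4.10 (b) and its proof (p. 58), Lemma 4.13, Ex. 1.6 (c).
  [MilneADT2006]
* J. W. S. Cassels, A. Fröhlich (eds.), *Algebraic Number Theory* (1967), Ch. VII (J. Tate) §7.3 Cor. 7.4 (b), §11.2 (bis).
  [CasselsFrohlichANT1967]
-/

noncomputable section

open Function NumberField IsDedekindDomain CategoryTheory CategoryTheory.Abelian groupCohomology
open scoped NumberField ContRepresentation

set_option linter.dupNamespace false
set_option autoImplicit false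

namespace Summit.BirchSwinnertonDyer.BirchSwinnertonDyer.Theorems.SchneiderFreeAdditiveX3.PoitouTateReduction

open Field
open Literature.NumberTheory.GaloisRepresentations Literature.NumberTheory.GaloisCohomology
open Literature.NumberTheory.GaloisRepresentations.DiscreteGaloisModule (mu TateDual tateDual localTatePairingZMod
  localTatePairingZMod_apply unramifiedSubgroup)
open Literature.Algebra.Homology Literature.Algebra.Homology.DiscreteRep Literature.Algebra.Homology.ExtPresentation
open Literature.NumberTheory.GaloisRepresentations.IdeleClassBar (classBarD classBarInv GalLayer)
open Literature.NumberTheory.GaloisRepresentations.FreePresentation (presentationComplex presentationComplex_shortExact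
  presModule₁ presModule₂ presIncl presProj pres_isSES moduleFinite_presModule₁ moduleFinite_presModule₂)
open Literature.NumberTheory.GaloisRepresentations.HomDual (IdeleProjection readout readoutInvariant localReadout
  readout_eq_localReadout charZero_of_algebra equivariantMap restrictIntertwining isSES_restrict
  localInvInf_H2π_eq_neg_zmodToQmodZ_localTatePairingZMod_localReadout)
open Literature.NumberTheory.GaloisRepresentations.DGMBridge (LCarrier)
open Literature.NumberTheory.GaloisRepresentations.IdeleReadout (ideleProjection layerEmb)
open Literature.NumberTheory.Automorphic (IdeleClassGroup.ideleRep)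
open Literature.AnabelianGeometry.AbsoluteAnabelian.Prop121vii (zmodToQmodZ brauerInvariantEquiv)

-- explicit cocycle classes on `Γ_{K_w}` need `LocallyCompactSpace`; the tree's theorem, local, no override.
attribute [local instance] absoluteGaloisGroup_compactSpace

variable {K : Type} [Field K] [NumberField K]

/-- **The E-side idèle package of a pair `(f, ŷ)` with threshold `T₀`** (a `Prop`, stated inline in the theorems below — kept as a
definition-free abbreviation in this docstring only): a layer `E`, an idèle `2`-cocycle `b` of `Gal(E/K)`, a class `x ∈ H¹(K, M)` and
`Tx ⊇ T₀ ∪ {v ∣ ∞}` with (P0) `x` unramified off `Tx`, (P1) `classBarInv K (ŷ ∘ ∂(f ≫ g)) = inv E [b]`, (P2) `localInv E v [b] = 0` off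
`Tx`, (P3) the finite dictionary, (P4) the archimedean transport at the real places.  **hE for EVERY number field `K` from such
packages.** [cite: MilneADT2006, I Thm. 4.10 (b) (proof, p. 58), Ex. 1.6 (c)][cite: CasselsFrohlichANT1967, Ch. VII §11.2 (bis)] -/
theorem poitouTate_selmerStructure_duality_of_idelePackage
    (hPkg : ∀ (n : ℕ) [NeZero n],
      ∀ ⦃M : Type⦄ [AddCommGroup M] [TopologicalSpace M] [DiscreteTopology M] [Finite M] [Finite (TateDual K M n)]
      (ρ₀ : DiscreteGaloisModule K M) (hM : ∀ m : M, n • m = 0)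
      (ι : ρ₀.toContRepresentation →ⁱL ((ρ₀.tateDual n).tateDual n).toContRepresentation),
      (∀ (m : M) (f : TateDual K M n), ι m f = f m) →
      ∀ (f : (presentationComplex ρ₀).X₁ ⟶ (ideleClassLimitShortComplex K).X₂)
        (ŷ : Abelian.Ext (triv (Γ := absoluteGaloisGroup K) ℤ) (presentationComplex ρ₀).X₃ 1) (T₀ : Finset (Place K)),
        ∃ (E : GalLayer K) (b : (haveI := E.numberField; cocycles₂ (IdeleClassGroup.ideleRep K E.1)))
          (x : galoisCohomology ρ₀ 1) (Tx : Finset (Place K)), T₀ ⊆ Tx ∧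
          (∀ w : InfinitePlace K, (Sum.inl w : Place K) ∈ Tx) ∧
          (∀ v : HeightOneSpectrum (𝓞 K), (Sum.inr v : Place K) ∉ Tx →
            galoisCohomology.localization ρ₀ (Sum.inr v) 1 x ∈ unramifiedSubgroup (GaloisRep.toLocal v ρ₀) 1) ∧
          (haveI := E.numberField; haveI := E.isGalois;
            classBarInv K (ŷ.comp (boundary (presentationComplex_shortExact ρ₀) (classBarD K)
              (f ≫ (ideleClassLimitShortComplex K).g)) (rfl : 1 + 1 = 2)) =
              IdeleCohomology.inv E.1 (H2π _ b)) ∧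
          (∀ v : HeightOneSpectrum (𝓞 K), (Sum.inr v : Place K) ∉ Tx →
            (haveI := E.numberField; haveI := E.isGalois; IdeleCohomology.localInv E.1 v (H2π _ b)) = 0) ∧
          (∀ v : HeightOneSpectrum (𝓞 K),
            (haveI := E.numberField; haveI := E.isGalois; IdeleCohomology.localInv E.1 v (H2π _ b)) =
              haveI := moduleFinite_presModule₁ ρ₀
              haveI : CharZero (v.adicCompletion K) := charZero_of_algebra (K := K) (v.adicCompletion K);
              brauerInvariantEquiv (v.adicCompletion K)
                (cohomologyMap (toTopRepHom ((presModule₁ ρ₀).restrictField (v.adicCompletion K))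
                    (DiscreteGaloisModule.units (v.adicCompletion K))
                    (equivariantMap ((presModule₁ ρ₀).restrictField (v.adicCompletion K))
                      (DiscreteGaloisModule.units (v.adicCompletion K))
                      (readoutInvariant (ideleProjection K (Sum.inr v)) (presentationComplex ρ₀).X₁ f))) 2
                  (galoisCohomology.res (presModule₁ ρ₀) (v.adicCompletion K) 2 ((pres_isSES ρ₀).δ₁ x)))) ∧
          (∀ w : InfinitePlace K, w.IsReal →
            ((haveI := E.numberField; haveI := E.isGalois;
              twoCocycleClass (DiscreteGaloisModule.units w.Completion).toTopRep
                ((IdeleCohomology.archReadoutPair w (layerEmb E)).pull b)) = 0 ↔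
              (haveI := moduleFinite_presModule₁ ρ₀
               cohomologyMap (toTopRepHom ((presModule₁ ρ₀).restrictField w.Completion) (DiscreteGaloisModule.units w.Completion)
                    (equivariantMap ((presModule₁ ρ₀).restrictField w.Completion) (DiscreteGaloisModule.units w.Completion)
                      (readoutInvariant (ideleProjection K (Sum.inl w)) (presentationComplex ρ₀).X₁ f))) 2
                  (galoisCohomology.res (presModule₁ ρ₀) w.Completion 2 ((pres_isSES ρ₀).δ₁ x))) = 0))) :
    poitouTate_selmerStructure_duality K := by
  refine poitouTate_selmerStructure_duality_of_reciprocitySum (K := K) fun n _ M _ _ _ _ _ ρ₀ hM ι hι f ŷ T₀ => ?_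
  obtain ⟨E, b, x, Tx, hT₀, hinf, hur, hP1, hP2, hP3, hP4⟩ := hPkg n ρ₀ hM ι hι f ŷ T₀
  refine ⟨x, Tx, hT₀, hur, fun T' hT' hsum => ?_⟩
  haveI := E.numberField
  haveI := E.isGalois
  haveI := E.finiteDimensional
  haveI := moduleFinite_presModule₁ ρ₀
  -- a biduality inverse `κ` for the given `ι`
  obtain ⟨ι', κ, hι', hκι', hικ⟩ := exists_bidual_intertwining (n := n) ρ₀ hM
  have hιι' : ∀ m : M, ι m = ι' m := fun m =>
    DiscreteGaloisModule.TateDual.ext fun g => by rw [hι, hι']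
  have hκι : ∀ m : M, κ (ι m) = m := fun m => by rw [hιι']; exact hκι' m
  have hκ : ∀ (Φ : TateDual K (TateDual K M n) n) (g : TateDual K M n), Φ g = g (κ Φ) := fun Φ g => by
    conv_lhs => rw [← hικ Φ]
    exact hι' (κ Φ) g
  -- the E-side value as one sum over `T'` (term-mode steps: no `rw` with coercion-headed patterns in this goal)
  refine hP1.trans ?_
  refine (IdeleCohomology.inv_eq_sum_place (E := E.1) (H2π _ b) T' (fun w => hT' (hinf w))
    (fun v hv => hP2 v fun h => hv (hT' h))).trans ?_
  -- termwise the E-side summand is minus the summand of the reciprocity sum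
  rw [← neg_eq_zero, ← Finset.sum_neg_distrib]
  refine Eq.trans (Finset.sum_congr rfl ?_) hsum
  rintro (w | v) -
  · -- infinite place: the archimedean dictionary (both sides `2`-torsion; transport only at real `w`)
    exact neg_eq_iff_eq_neg.mpr
      (localInvInf_H2π_eq_neg_zmodToQmodZ_localTatePairingZMod_localReadout ρ₀ n hM w (layerEmb E) b ι κ hκι hκ _ x (hP4 w))
  · -- finite place: the finite dictionary
    exact neg_eq_iff_eq_neg.mpr ((hP3 v).trans (neg_neg _).symm)

/-- **Totally complex base: hE from the E-side value, the finite support and the finite dictionary alone** ((P4) vacuous, no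
infinite place required in `Tx`; the archimedean summands vanish on both sides) — the shape of door-c6 g18's assembly (L2).
[cite: MilneADT2006, I Thm. 4.10 (b) (proof, p. 58)][cite: CasselsFrohlichANT1967, Ch. VII §11.2 (bis)] -/
theorem poitouTate_selmerStructure_duality_of_idelePackage_of_isTotallyComplex [IsTotallyComplex K]
    (hPkg : ∀ (n : ℕ) [NeZero n],
      ∀ ⦃M : Type⦄ [AddCommGroup M] [TopologicalSpace M] [DiscreteTopology M] [Finite M] [Finite (TateDual K M n)]
      (ρ₀ : DiscreteGaloisModule K M) (hM : ∀ m : M, n • m = 0)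
      (ι : ρ₀.toContRepresentation →ⁱL ((ρ₀.tateDual n).tateDual n).toContRepresentation),
      (∀ (m : M) (f : TateDual K M n), ι m f = f m) →
      ∀ (f : (presentationComplex ρ₀).X₁ ⟶ (ideleClassLimitShortComplex K).X₂)
        (ŷ : Abelian.Ext (triv (Γ := absoluteGaloisGroup K) ℤ) (presentationComplex ρ₀).X₃ 1) (T₀ : Finset (Place K)),
        ∃ (E : GalLayer K) (b : (haveI := E.numberField; cocycles₂ (IdeleClassGroup.ideleRep K E.1)))
          (x : galoisCohomology ρ₀ 1) (Tx : Finset (Place K)), T₀ ⊆ Tx ∧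
          (∀ v : HeightOneSpectrum (𝓞 K), (Sum.inr v : Place K) ∉ Tx →
            galoisCohomology.localization ρ₀ (Sum.inr v) 1 x ∈ unramifiedSubgroup (GaloisRep.toLocal v ρ₀) 1) ∧
          (haveI := E.numberField; haveI := E.isGalois;
            classBarInv K (ŷ.comp (boundary (presentationComplex_shortExact ρ₀) (classBarD K)
              (f ≫ (ideleClassLimitShortComplex K).g)) (rfl : 1 + 1 = 2)) =
              IdeleCohomology.inv E.1 (H2π _ b)) ∧
          (∀ v : HeightOneSpectrum (𝓞 K), (Sum.inr v : Place K) ∉ Tx →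
            (haveI := E.numberField; haveI := E.isGalois; IdeleCohomology.localInv E.1 v (H2π _ b)) = 0) ∧
          (∀ v : HeightOneSpectrum (𝓞 K),
            (haveI := E.numberField; haveI := E.isGalois; IdeleCohomology.localInv E.1 v (H2π _ b)) =
              haveI := moduleFinite_presModule₁ ρ₀
              haveI : CharZero (v.adicCompletion K) := charZero_of_algebra (K := K) (v.adicCompletion K);
              brauerInvariantEquiv (v.adicCompletion K)
                (cohomologyMap (toTopRepHom ((presModule₁ ρ₀).restrictField (v.adicCompletion K))
                    (DiscreteGaloisModule.units (v.adicCompletion K))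
                    (equivariantMap ((presModule₁ ρ₀).restrictField (v.adicCompletion K))
                      (DiscreteGaloisModule.units (v.adicCompletion K))
                      (readoutInvariant (ideleProjection K (Sum.inr v)) (presentationComplex ρ₀).X₁ f))) 2
                  (galoisCohomology.res (presModule₁ ρ₀) (v.adicCompletion K) 2 ((pres_isSES ρ₀).δ₁ x))))) :
    poitouTate_selmerStructure_duality K := by
  refine poitouTate_selmerStructure_duality_of_reciprocitySum (K := K) fun n _ M _ _ _ _ _ ρ₀ hM ι hι f ŷ T₀ => ?_
  obtain ⟨E, b, x, Tx, hT₀, hur, hP1, hP2, hP3⟩ := hPkg n ρ₀ hM ι hι f ŷ T₀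
  refine ⟨x, Tx, hT₀, hur, fun T' hT' hsum => ?_⟩
  haveI := E.numberField
  haveI := E.isGalois
  haveI := E.finiteDimensional
  haveI := moduleFinite_presModule₁ ρ₀
  refine hP1.trans ?_
  refine (IdeleCohomology.inv_eq_sum_place_of_isTotallyComplex (E := E.1) (H2π _ b) T'
    (fun v hv => hP2 v fun h => hv (hT' h))).trans ?_
  rw [← neg_eq_zero, ← Finset.sum_neg_distrib]
  refine Eq.trans (Finset.sum_congr rfl ?_) hsum
  rintro (w | v) -
  · -- infinite place: both summands vanish at a complex place
    have h1 : IdeleCohomology.localInvInf E.1 w (H2π _ b) = 0 := IdeleCohomology.localInvInf_eq_zero_of_isTotallyComplex w _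
    refine neg_eq_iff_eq_neg.mpr (h1.trans ?_)
    dsimp only [Sum.elim_inl]
    rw [localTatePairingZMod_apply, LocalInvariants.canonical_inl_eq_zero_of_isComplex (IsTotallyComplex.isComplex w),
      map_zero, neg_zero]
  · exact neg_eq_iff_eq_neg.mpr ((hP3 v).trans (neg_neg _).symm)

end Summit.BirchSwinnertonDyer.BirchSwinnertonDyer.Theorems.SchneiderFreeAdditiveX3.PoitouTateReduction

end
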